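import Summits.ResolutionOfSingularities.ResolutionOfSingularities.Theorems.FrobeniusClosingSteerSwitchPlaneChart
import Literature.AlgebraicGeometry.Resolution.RegularLocalRingsNormal
import Mathlib.Algebra.CharP.Lemmas
import Mathlib.RingTheory.IntegralClosure.IntegrallyClosed
import HarnessLib

/-!
# The switch plane after a decomposed stage (B13a-1″ of res-L0-w41-strat-2's σ-residual HIGH half, part 2/2: assembly)

W4.1, crux `Steer` (stmt-ResolutionOfSingularities-16345), σ-line at `p = 2`; res-L0-w41-strat-2's delta rev 10
(`R2TwoSigma-s16-strat2.delta.lean` 11a4c8131b8ae2f9) stub **B13a-1″ `switch_plane_of_decomposition_two`**, dealt to this seat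
by res-L0-w41-plan-1's DEAL AMENDMENT 2026-08-27T07:57:36Z; prover plan `STUBPLAN-B13.md` steps D2–D4 (part 1/2,
`FrobeniusClosingSteerSwitchPlaneChart.lean`) and D3 + assembly (this file). Theses-free and def-free: the skeleton's
`IsSteeredRun` / `IsPointStep` / `IsExcParamAlong` / `IsStrictStepAlong` are consumed UNFOLDED, so that the holder's in-file leaf
is a three-line `obtain … exact`.

Content. For one local blowing up `S ⊂ S'` of a regular local subring `S ⊆ K` (char `K = 2`) along `𝔪_S` with respect to `O`,
`S` dominated by `O`, `S'` regular of Krull dimension `4`, a strict step `s₁ = π s₂ + g` of the torsor generator with `π` an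
exceptional parameter (non-zero element of `𝔪_S` of maximal value), and a DECOMPOSED radicand `s₁² = x ρ + G²` with
`ρ ∈ 𝔪_S²`, `x ∉ 𝔪_S²` and `v x < v π` (a switch):

* `div_sq_mem_transform` — `ρ / π² ∈ S'` for `ρ ∈ 𝔪_S²` (`𝔪_S² / π² ⊆ S[𝔪_S/π] ⊆ S'`);
* `mem_of_sq_mem_transform` — normality of the regular local ring `S'`: a quotient `a / π` (`a ∈ S'`) whose square lies in
  `S'` lies in `S'` (`IsIntegrallyClosed.pow_dvd_pow_iff`);
* `radicand_step_eq` — the characteristic-2 identity `s₂² = π · (x/π) · (ρ/π²) + ((G − g)/π)²`;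
* `switch_plane_of_decomposition` — **the def-free core**: `Q = (π, x/π) ⊂ S'` is a prime with `S'/Q` regular local of
  dimension `2` and `s₂² − ((G − g)/π)² ∈ Q²`;
* `switch_plane_of_decomposition_adapter` — the same with the hypotheses in the literal unfolded shape of the skeleton's
  binders (`hrun.2 (i+1)`, `hpt`, `hρ`, `hf`, `hsw`, `hrun.2 (i+2)`), for the holder's leaf:
  `obtain ⟨hl, hs, -, hbl, hst⟩ := hrun.2 (i + 1); obtain ⟨-, hs₂, -⟩ := hrun.2 (i + 2);
   exact SwitchPlane.switch_plane_of_decomposition_adapter O R P s i hR hreg hdim ⟨hl, hs, hbl, hst⟩ hpt x hx0 hx₁ ρ G hρ hf hsw hs₂`.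

No Theses file of W4.1 is imported; nothing here is a route item. OURS (the W4.1 engine), standard commutative algebra; NOT a
statement of the manuscript under review [claim: Hironaka2017, status: under-review]. [cite: Matsumura1987, Thm. 14.2, Thm. 19.4]
[cite: HeinzerEtAl2015, Lemma 2.7] [cite: NovacoskiSpivakovsky2014, Def. 2.11]
-/

noncomputable section

-- `Summit.<S>.<S>.…` duplicates the summit name by design (single-problem summit).
set_option linter.dupNamespace false

open IsLocalRing Literature.AlgebraicGeometry.Resolution

namespace Summit.ResolutionOfSingularities.ResolutionOfSingularities.Theorems.SwitchingDichotomy.SwitchPlane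

variable {K : Type} [Field K]

/-! ## §1 Two membership lemmas in the transform -/

/-- **`𝔪_S² / π² ⊆ S'`**: for the local blowing up `S ⊂ S'` along `𝔪_S` with respect to `O` in the chart of the exceptional
parameter `π`, every `ρ ∈ 𝔪_S²` has `ρ / π² ∈ S'` (`𝔪_S^L/π^L ⊆ S[𝔪_S/π]`, `QuadraticStep.div_pow_mem_blowupRing`, and
`S' = (S[𝔪_S/π])_{𝔪_O ∩ S[𝔪_S/π]}`, `DivisorTrigger.eq_locAtCentre_blowupRing`). [cite: NovacoskiSpivakovsky2014, Def. 2.11] -/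
theorem div_sq_mem_transform {O : ValuationSubring K} {S S' : Subring K} [IsLocalRing S]
    (hbl : IsLocalBlowupAlong O S (maximalIdeal S) S') {π : K} (hπS : π ∈ S)
    (hπm : (⟨π, hπS⟩ : S) ∈ maximalIdeal S) (hπ0 : π ≠ 0)
    (hπmax : ∀ y : S, y ∈ maximalIdeal S → O.valuation (y : K) ≤ O.valuation π)
    {ρ : S} (hρ : ρ ∈ maximalIdeal S ^ 2) : (ρ : K) / π ^ 2 ∈ S' := by
  have hS' : S' = locAtCentre (blowupRing S π) O :=
    DivisorTrigger.eq_locAtCentre_blowupRing hbl hπS hπm hπ0 hπmax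
  have h := QuadraticStep.div_pow_mem_blowupRing (⟨π, hπS⟩ : S) hρ
  rw [hS']
  exact le_locAtCentre _ O h

/-- **Normality of the regular transform**: if `a ∈ S'` (regular local, hence an integrally closed domain — Matsumura 19.4)
and `π ∈ S'`, `π ≠ 0`, with `(a / π)² ∈ S'`, then `a / π ∈ S'` (`π² ∣ a²` forces `π ∣ a`,
`IsIntegrallyClosed.pow_dvd_pow_iff`). [cite: Matsumura1987, Thm. 19.4] -/
theorem mem_of_sq_mem_transform {S' : Subring K} [IsRegularLocalRing S'] {a π : K} (ha : a ∈ S') (hπ : π ∈ S')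
    (hπ0 : π ≠ 0) (hsq : (a / π) ^ 2 ∈ S') : a / π ∈ S' := by
  haveI : IsIntegrallyClosed S' := isIntegrallyClosed_of_isRegularLocalRing _
  have hdvd : (⟨π, hπ⟩ : S') ^ 2 ∣ (⟨a, ha⟩ : S') ^ 2 := by
    refine ⟨⟨(a / π) ^ 2, hsq⟩, Subtype.ext ?_⟩
    change a ^ 2 = π ^ 2 * (a / π) ^ 2
    field_simp
  obtain ⟨c, hc⟩ := (IsIntegrallyClosed.pow_dvd_pow_iff two_ne_zero).mp hdvd
  have hc' : a = π * (c : K) := by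
    have h := congrArg Subtype.val hc
    simpa only [Subring.coe_mul] using h
  have : a / π = (c : K) := by
    rw [hc', mul_div_cancel_left₀ _ hπ0]
  rw [this]
  exact c.2

/-! ## §2 The characteristic-2 identity of the step -/

/-- **The radicand after the step, decomposed** (char 2): from `s₁ = π s₂ + g` and `s₁² = x ρ + G²`,
`s₂² = π · (x/π) · (ρ/π²) + ((G − g)/π)²`. [folklore] -/
theorem radicand_step_eq [CharP K 2] {π g s₁ s₂ x ρ G : K} (hπ0 : π ≠ 0) (hstep : s₁ = π * s₂ + g)
    (hf : s₁ ^ 2 = x * ρ + G ^ 2) :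
    s₂ ^ 2 = π * (x / π) * (ρ / π ^ 2) + ((G - g) / π) ^ 2 := by
  haveI : Fact (Nat.Prime 2) := ⟨Nat.prime_two⟩
  have hs₂ : s₂ = (s₁ - g) / π := by
    rw [hstep]
    field_simp
    ring
  have h1 : (s₁ - g) ^ 2 = s₁ ^ 2 - g ^ 2 := sub_pow_char (R := K) s₁ g
  have h2 : (G - g) ^ 2 = G ^ 2 - g ^ 2 := sub_pow_char (R := K) G g
  rw [hs₂, div_pow, div_pow, h1, h2, hf]
  field_simp
  ring

/-! ## §3 B13a-1″, def-free core -/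

/-- **B13a-1″ (def-free core) · a switch after a decomposed stage creates an equimultiple regular plane.** Let `S ⊂ S'`
be the local blowing up of the regular local subring `S ⊆ K` (`char K = 2`, `S` dominated by `O`) along `𝔪_S` with respect
to `O`, `S'` regular local of Krull dimension `4`; let `s₁ = π s₂ + g` be a strict step of the torsor generator with `g ∈ S`
and `π ∈ 𝔪_S` non-zero of maximal value; let `s₁² = x ρ + G²` with `ρ ∈ 𝔪_S²`, `x ∈ S ∖ 𝔪_S²`, and `v x < v π` (a SWITCH:
`x` is not an exceptional parameter of this step). Then `Q := (π, x/π) ⊂ S'` is a prime ideal with `S'/Q` regular local of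
dimension `2` (part 1/2: `switch_plane_quotient_dim_two`) and `s₂² − ((G − g)/π)² = π · (x/π) · (ρ/π²) ∈ Q²`, the cleaner
`(G − g)/π` lying in `S'` by normality. OURS. [cite: Matsumura1987, Thm. 14.2, Thm. 19.4] [cite: HeinzerEtAl2015, Lemma 2.7] -/
theorem switch_plane_of_decomposition [CharP K 2] {O : ValuationSubring K} {S S' : Subring K}
    [IsRegularLocalRing S] [IsRegularLocalRing S']
    (hbl : IsLocalBlowupAlong O S (maximalIdeal S) S') (hdom : SubringDominates S O.toSubring)
    (hdim : ringKrullDim S' = 4)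
    {π g s₁ s₂ : K} (hπS : π ∈ S) (hπm : (⟨π, hπS⟩ : S) ∈ maximalIdeal S) (hπ0 : π ≠ 0)
    (hπmax : ∀ y : S, y ∈ maximalIdeal S → O.valuation (y : K) ≤ O.valuation π)
    (hgS : g ∈ S) (hstep : s₁ = π * s₂ + g)
    {x : K} (hxS : x ∈ S) (hx2 : (⟨x, hxS⟩ : S) ∉ maximalIdeal S ^ 2) (ρ G : S)
    (hρ : ρ ∈ maximalIdeal S ^ 2) (hf : s₁ ^ 2 = x * (ρ : K) + (G : K) ^ 2)
    (hlt : O.valuation x < O.valuation π) (hs₂ : s₂ ^ 2 ∈ S') :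
    ∃ (Q : Ideal S') (_ : Q.IsPrime) (g' : S'),
      IsRegularLocalRing (S' ⧸ Q) ∧ ringKrullDim (S' ⧸ Q) = 2 ∧ (⟨s₂ ^ 2, hs₂⟩ : S') - g' ^ 2 ∈ Q ^ 2 := by
  obtain ⟨_, hπ', hx', hxm', hprime, hreg, hdim2⟩ :=
    switch_plane_quotient_dim_two hbl hdom hπS hπm hπ0 hπmax hxS hx2 hlt hdim
  have hSS' : S ≤ S' := (IsQuadraticTransformAlong.le ⟨inferInstance, hbl⟩)
  -- the three factors and the cleaner
  have hρ' : (ρ : K) / π ^ 2 ∈ S' := div_sq_mem_transform hbl hπS hπm hπ0 hπmax hρ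
  have hid := radicand_step_eq (x := x) (ρ := (ρ : K)) (G := (G : K)) hπ0 hstep hf
  have hG₃sq : ((G : K) - g) / π * (((G : K) - g) / π) ∈ S' := by
    have h : (((G : K) - g) / π) ^ 2 = s₂ ^ 2 - π * (x / π) * ((ρ : K) / π ^ 2) := by
      rw [hid]; ring
    rw [← pow_two, h]
    exact S'.sub_mem hs₂ (S'.mul_mem (S'.mul_mem hπ' hx') hρ')
  have hG₃ : ((G : K) - g) / π ∈ S' :=
    mem_of_sq_mem_transform (S'.sub_mem (hSS' G.2) (hSS' hgS)) hπ' hπ0 (by rw [pow_two]; exact hG₃sq)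
  -- `s₂² − G₃² = π · (x/π) · (ρ/π²) ∈ Q²`
  have heq : (⟨s₂ ^ 2, hs₂⟩ : S') - ⟨((G : K) - g) / π, hG₃⟩ ^ 2 =
      ⟨π, hπ'⟩ * ⟨x / π, hx'⟩ * ⟨(ρ : K) / π ^ 2, hρ'⟩ := by
    apply Subtype.ext
    simp only [AddSubgroupClass.coe_sub, Subring.coe_mul, SubmonoidClass.coe_pow]
    rw [hid]
    ring
  have hπQ : (⟨π, hπ'⟩ : S') ∈ Ideal.span {(⟨π, hπ'⟩ : S'), ⟨x / π, hx'⟩} :=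
    Ideal.subset_span (Set.mem_insert _ _)
  have hxQ : (⟨x / π, hx'⟩ : S') ∈ Ideal.span {(⟨π, hπ'⟩ : S'), ⟨x / π, hx'⟩} :=
    Ideal.subset_span (Set.mem_insert_of_mem _ (Set.mem_singleton _))
  have hmem : (⟨s₂ ^ 2, hs₂⟩ : S') - ⟨((G : K) - g) / π, hG₃⟩ ^ 2 ∈
      Ideal.span {(⟨π, hπ'⟩ : S'), ⟨x / π, hx'⟩} ^ 2 := by
    rw [heq, pow_two]
    exact Ideal.mul_mem_right _ _ (Ideal.mul_mem_mul hπQ hxQ)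
  exact ⟨_, hprime, ⟨((G : K) - g) / π, hG₃⟩, hreg, hdim2, hmem⟩

/-! ## §4 The adapter in the skeleton's unfolded binders -/

/-- **B13a-1″ in the literal unfolded shape of the skeleton's binders** (`R : ℕ → Subring K`, stage `i + 1 → i + 2`):
`hstage` is `hrun.2 (i+1)` minus its σ_top clause (`IsLocalBlowupAlong` + `IsStrictStepAlong` unfolded: `∃ π g, IsExcParamAlong ∧
g ∈ R (i+1) ∧ s (i+1) = π * s (i+2) + g`, `IsExcParamAlong` unfolded), `hpt` is `IsPointStep R P (i+1)` unfolded, `hρ`/`hf` are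
strat-2's binders verbatim, `hsw` is `¬ IsExcParamAlong O (R (i+1)) (P (i+1)) x` unfolded, `hs₂` is the membership clause of
`hrun.2 (i+2)`. Conclusion = strat-2's `switch_plane_of_decomposition_two` verbatim. OURS. [cite: Matsumura1987, Thm. 14.2]
[cite: HeinzerEtAl2015, Lemma 2.7] -/
theorem switch_plane_of_decomposition_adapter [CharP K 2] (O : ValuationSubring K) (R : ℕ → Subring K)
    (P : (i : ℕ) → Ideal (R i)) (s : ℕ → K) (i : ℕ)
    (hR : ∀ j, ∃ B : Subring K, B ≤ O.toSubring ∧ R j = locAtCentre B O)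
    (hreg : ∀ j, IsRegularLocalRing (R j)) (hdim : ∀ j, ringKrullDim (R j) = 4)
    (hstage : ∃ (_ : IsLocalRing (R (i + 1))) (_ : s (i + 1) ^ 2 ∈ R (i + 1)),
      IsLocalBlowupAlong O (R (i + 1)) (P (i + 1)) (R (i + 2)) ∧
      ∃ π g : K, ((∃ hπ : π ∈ R (i + 1), (⟨π, hπ⟩ : R (i + 1)) ∈ P (i + 1)) ∧ π ≠ 0 ∧
          ∀ y : R (i + 1), y ∈ P (i + 1) → O.valuation (y : K) ≤ O.valuation π) ∧
        g ∈ R (i + 1) ∧ s (i + 1) = π * s (i + 2) + g)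
    (hpt : ∃ _ : IsLocalRing (R (i + 1)), P (i + 1) = maximalIdeal (R (i + 1)))
    (x : K) (hx0 : x ≠ 0) (hx₁ : x ∈ R (i + 1)) (ρ G : R (i + 1))
    (hρ : ∃ _ : IsLocalRing (R (i + 1)), ρ ∈ maximalIdeal (R (i + 1)) ^ 2 ∧
      (⟨x, hx₁⟩ : R (i + 1)) ∈ maximalIdeal (R (i + 1)) ∧ (⟨x, hx₁⟩ : R (i + 1)) ∉ maximalIdeal (R (i + 1)) ^ 2)
    (hf : ∃ hs : s (i + 1) ^ 2 ∈ R (i + 1), (⟨s (i + 1) ^ 2, hs⟩ : R (i + 1)) = ⟨x, hx₁⟩ * ρ + G ^ 2)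
    (hsw : ¬ ((∃ hx : x ∈ R (i + 1), (⟨x, hx⟩ : R (i + 1)) ∈ P (i + 1)) ∧ x ≠ 0 ∧
      ∀ y : R (i + 1), y ∈ P (i + 1) → O.valuation (y : K) ≤ O.valuation x))
    (hs₂ : s (i + 2) ^ 2 ∈ R (i + 2)) :
    ∃ (hs : s (i + 2) ^ 2 ∈ R (i + 2)) (Q : Ideal (R (i + 2))) (_ : Q.IsPrime) (g : R (i + 2)),
      IsRegularLocalRing (R (i + 2) ⧸ Q) ∧ ringKrullDim (R (i + 2) ⧸ Q) = 2 ∧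
        (⟨s (i + 2) ^ 2, hs⟩ : R (i + 2)) - g ^ 2 ∈ Q ^ 2 := by
  haveI := hreg (i + 1)
  haveI := hreg (i + 2)
  obtain ⟨_, _, hbl, π, g, ⟨⟨hπS, hπP⟩, hπ0, hπmax⟩, hgS, hstep⟩ := hstage
  obtain ⟨_, hP⟩ := hpt
  obtain ⟨_, hρm, hxm, hx2⟩ := hρ
  obtain ⟨hs₁, hf⟩ := hf
  obtain ⟨B, hBO, hRB⟩ := hR (i + 1)
  have hdom : SubringDominates (R (i + 1)) O.toSubring := by
    rw [hRB]; exact subringDominates_locAtCentre hBO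
  -- rewrite the centre as the maximal ideal
  have hbl' : IsLocalBlowupAlong O (R (i + 1)) (maximalIdeal (R (i + 1))) (R (i + 2)) := by
    rw [← hP]; exact hbl
  have hπm : (⟨π, hπS⟩ : R (i + 1)) ∈ maximalIdeal (R (i + 1)) := by rw [← hP]; exact hπP
  have hπmax' : ∀ y : R (i + 1), y ∈ maximalIdeal (R (i + 1)) → O.valuation (y : K) ≤ O.valuation π :=
    fun y hy => hπmax y (by rw [hP]; exact hy)
  -- the switch as a strict inequality of values
  have hlt : O.valuation x < O.valuation π := by
    refine valuation_lt_of_not_forall_le hπmax fun h => hsw ⟨⟨hx₁, ?_⟩, hx0, h⟩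
    rw [hP]; exact hxm
  have hfK : s (i + 1) ^ 2 = x * (ρ : K) + (G : K) ^ 2 := by
    have h := congrArg Subtype.val hf
    simpa only [Subring.coe_add, Subring.coe_mul, SubmonoidClass.coe_pow] using h
  obtain ⟨Q, hQ, g', hreg', hdim', hmem⟩ :=
    switch_plane_of_decomposition hbl' hdom (hdim (i + 2)) hπS hπm hπ0 hπmax' hgS hstep hx₁ hx2 ρ G hρm
      hfK hlt hs₂
  exact ⟨hs₂, Q, hQ, g', hreg', hdim', hmem⟩

end Summit.ResolutionOfSingularities.ResolutionOfSingularities.Theorems.SwitchingDichotomy.SwitchPlane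

end
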